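import Literature.NumberTheory.EllipticCurves.BDPBranchPAdicLFunction
import Literature.NumberTheory.GaloisRepresentations.HeckeCharacterConductorExponent
import HarnessLib

/-!
# Castella–Hsieh 2018, Def. 3.7 + Prop. 3.8 ON A BRANCH OF CONDUCTOR `p`: the `χ`-branch
# `ℒ_𝔭(f)(χ̂ ·)` of the BDP anticyclotomic `p`-adic `L`-function EXISTS (good `p` split in `K`)

F. Castella, M.-L. Hsieh, *Heegner cycles and p-adic L-functions*, Math. Ann. **370** (2018)
567–628 = arXiv:1505.08165v1 (held `paper:arxiv-1505.08165`; the v1 TeX pages are quoted, journal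
numbering in brackets). §3.3 (v1 p. 9): "A Hecke character `χ : K^×\𝔸_K^× → ℂ^×` … is called
anticyclotomic if `χ` is trivial on `𝔸^×`"; (v1 p. 10) "Let `K_{p^∞} = ∪_n K_{p^n}` be the ring
class field of conductor `p^∞` and let `Γ̃ := Gal(K_{p^∞}/K)`. Then the Galois group `Γ_K^-` of the
anticyclotomic `ℤ_p`-extension over `K` is the maximal free quotient of `Γ̃`"; "`𝔛_{p^∞}` … the set
of locally algebraic characters `ρ : Γ̃ → 𝒪_{ℂ_p}^×`"; **Definition 3.5 [3.7]** (the measure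
`ℒ_{𝔭,ψ}(f)` on `Γ̃`, "an element in the semi-local ring `𝒲⟦Γ̃⟧`", `𝒲` = ring of integers of
`ℚ̂_p^{ur}` (v1 p. 7), periods "`(Ω_K, Ω_p) ∈ ℂ^× × 𝒲^×`" (v1 p. 7)); **Proposition 3.6 [3.8]**
(v1 p. 11, verbatim): "If `φ̂ ∈ 𝔛_{p^∞}` is the avatar of a Hecke character `φ` of infinity type
`(m, −m)` with `m ≥ 0` and `p`-power conductor, then `(ℒ_{𝔭,ψ}(f)(φ̂)/Ω_p^{2r+2m})² =
L^{alg}(½, π_K ⊗ ψφ) · e_𝔭(f, ψφ) · φ(𝔑⁻¹) · 2^{#A(ψ)+3} c_o ε(f) · u_K² √D_K`", under "(Heeg′), (ST)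
for `(f, ψ)` and `(c_o, pN⁺) = 1`", with the multiplier (v1 p. 10, display before Prop. 3.4)
"`e_𝔭(f, χ) = (1 − a_p(f) p^{−r} χ_𝔭̄(p) + χ_𝔭̄(p²) p^{−1})²` if `p ∤ c`, `ε(½, χ_𝔭)^{−2}` if `p ∣ c`"
(`c𝒪_K` the conductor of `χ`). Running hypotheses: "Fix an odd prime `p ∤ N`" (v1 p. 3), "`p > 2` …
split in `𝒪_K`" (v1 p. 6), and (Heeg) "`N` is a product of primes split in `K`. Thus (Heeg′) and (ST)
will automatically hold" (§4.1, v1 p. 12). NO hypothesis on `ρ̄_{f,p}` in the analytic §3.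
PUBLISHED / REFEREED.

## What this file states

ONE named fact, `castellaHsieh2018_exists_isBranchBDPLFunction`: the SIBLING of the registered fact
`castellaHsieh2018_exists_isBDPLFunction` (`CastellaHsieh2018/BDPLFunctionExistence.lean`, whose
binders up to the topological generator are repeated VERBATIM) in the currency of the tree's branch
predicate `IsBranchBDPLFunction ι 𝔭 κ γ f χ e Ω_K Ω_p L` (`BDPBranchPAdicLFunction.lean`, item
`defn-BranchBDPLFunction`, variant (b): interpolation at the characters `χφ`, `φ` unramified of
infinity type `(−n, n)`, `n > 0`, with Castella–Hsieh's RAMIFIED multiplier `e · φ(𝔭)^{−2}`,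
`e` meant `ε(½, χ_𝔭)^{−2}`). Where the sibling keeps only the unramified characters of
Prop. 3.6 [3.8] (the case `p ∤ c` of `e_𝔭`), this fact keeps the characters of conductor exactly
`p𝒪_K = 𝔭𝔭̄` on the branch of a QUADRATIC branch character `χ` — the case `p ∣ c`.

The branch character. The tree has no predicate "anticyclotomic" for Hecke characters, so the
class of branch characters is cut out by three hypotheses in the tree's vocabulary: `χ² = 1`,
`χ` unramified at every finite place `w ∤ p` (`HeckeCharacter.IsUnramifiedAt`), and conductor
exponent exactly `1` at every prime `𝔮 ∣ p` (`HeckeCharacter.HasConductorExponentAt χ 𝔮 1`, the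
tree's conductor notion, `HeckeCharacterConductorExponent.lean`). For `p` odd and split these are
EXACTLY the characters `χ_ε · ν` with `χ_ε = ε_{p*} ∘ N_{K/ℚ}` the genus character of the quadratic
Dirichlet character `ε_{p*}` of conductor `p` (Keller–Yin's `χ_ε`, arXiv:2410.23241 Prop. 3.1.3,
proof, p. 14: "`χ_ε := ε⁻¹ ∘ Nm_{K/ℚ}`") and `ν` a quadratic character of the class group: a
quadratic character of `ℤ_p^× = 𝒪_{K_𝔮}^×` trivial on `1 + p ℤ_p` and non-trivial is the Legendre
symbol, so `χ χ_ε^{−1}` is trivial on `∏_v 𝒪_v^× · K_∞^×` (both have finite order, hence trivial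
infinity component, `ℂ^×` being connected), i.e. factors through `Cl_K`. Every such `χ` is trivial on
`𝔸_ℚ^× = ℚ^× · ∏_ℓ ℤ_ℓ^× · ℝ_{>0}` (`ε_{p*}(N x) = ε_{p*}(x)² = 1`; class-group characters vanish on
`∏ ℤ_ℓ^× ℝ_{>0} ⊂ ∏ 𝒪_v^× K_∞^×`), i.e. ANTICYCLOTOMIC in Castella–Hsieh's sense, of conductor `p𝒪_K`,
and `χ̂ = χ` is a character of `Gal(K_p/K)` (trivial on `ℤ_p^× (1 + p𝒪_K ⊗ ℤ_p) = (ℤ_p + p 𝒪_K ⊗ ℤ_p)^×`),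
a quotient of `Γ̃`: so for every `φ` in the range of `IsBranchBDPLFunction` (unramified, infinity
type `(−n, n)`, `n > 0`, avatar through the anticyclotomic `ℤ_p`-extension) the product `χφ` has
`p`-power conductor `p𝒪_K` and locally algebraic avatar on `Γ̃` — Prop. 3.6 [3.8] applies to it, with
the multiplier `e_𝔭(f, χφ) = ε(½, (χφ)_𝔭)^{−2}` (`p ∣ c`). This covers the consumer's `χ_ε`
(`ν = 1`). TODO(general form): all finite-order anticyclotomic `χ` of `p`-power conductor (variant (a)
of `defn-BranchBDPLFunction`; needs Tate's local constant as a function of `φ`, not in the tree).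

How the statement follows from print (exactly as for the sibling, module docstring of
`BDPLFunctionExistence.lean`, and for `castella2018_exists_isBDPLFunction`): Castella 2018 Thm. 3.1
(arXiv:1704.06608 p. 9: "the construction in [cas-hsieh1] readily extends") IS Castella–Hsieh's
construction at `p ∤ N`, read through the twist `Tw_{ψ⁻¹}` by the auxiliary character of Def. 3.5
[3.7]; the `χ`-branch is `Tw_χ̂` of the same element of `𝒲⟦Γ̃⟧` (`χ` has values `±1 ∈ 𝒲`) pushed to
`𝒲⟦Γ⟧ = R₀⟦T⟧` (`1 + T ↔ γ`) — Keller–Yin's "`ℒ_ε := ℒ_p(f̃)(χ_ε) := χ_ε(ℒ_p(f̃))`" (arXiv:2410.23241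
§3.4 p. 19; only the NAME is theirs). Its value at `φ̂` is Prop. 3.6 [3.8] at `ψ⁻¹χφ` (infinity type
`(n−1, −(n−1))`, `p`-power conductor): the sibling's display with `L(f/K, φ, 1) ↦ L(f/K, χφ, 1)` and
the unramified multiplier replaced by `ε(½, (χφ)_𝔭)^{−2} = ε(½, χ_𝔭)^{−2} φ_𝔭(p)^{−2}` (unramified
twist, `a(χ_𝔭) = 1`; [TateNTB1979] (3.2.3)), the CM periods `Ω_K ∈ ℂ^×`, `Ω_p ∈ 𝒲^×` and the branch
constant `e` quantified EXISTENTIALLY. About `e`: MEANT `ε(½, χ_𝔭)^{−2}` times the `φ`-independent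
algebraic constants by which Prop. 3.6 [3.8] at `ψ⁻¹χφ` and at `ψ⁻¹φ` differ (`χ(𝔑⁻¹) = ±1`); for a
quadratic `χ_𝔭` Tate's local functional equation gives `ε(½, χ_𝔭)² = χ_𝔭(−1) = ±1`. NONE of this is
asserted: the fact pins only `e ≠ 0` (local constants are non-zero), `Ω_K ≠ 0`, `Ω_p ∈ R₀^×`.

Scope caveats (recorded, not resolved; those of `BDPBranchPAdicLFunction.lean` verbatim): the prime
at which `φ` is read (`𝔭` of the embedding datum vs `𝔭̄`), and the explicit constants of Prop. 3.6
[3.8] (`φ(𝔑⁻¹)`, `2^{#A(ψ)+3} c_o ε(f) u_K² √D_K`, the `(4π)`/`Im ϑ` normalisation of `L^{alg}`)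
absorbed in Castella's reformulation exactly as for `IsBDPLFunction`. Weight 2 and rational
coefficients only (`f` the newform of an elliptic curve, so `𝒪_F = ℤ_p` and `L ∈ R₀⟦T⟧`). NOT here:
the value formula at finite-order characters (Lemma 5.4 + Thm. 5.7 [journal], item `wi-73260`), any
main conjecture, anything at `p ∣ N` or `p = 2`.

Consumer: BSD route `SchneiderFreeAdditiveX3`, crux r3 (`stmt-BirchSwinnertonDyer-19177`), layer-2
input H1 `BranchBDPExistsAt` via the door memo `door-c3-g8-branch-currency.md` §3 (F_a): the frame
`(e, Ω_K, Ω_p, L)` of the Heegner pair `(f̃, χ_ε)`, `f̃` the newform of the good twist `W′`, `p ∤ N′`.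

* `castellaHsieh2018_exists_isBranchBDPLFunction` — the named fact (ONE `def … : Prop`).

References: [CastellaHsieh2018] Def. 3.7, Prop. 3.8, §3.3 multiplier `e_𝔭` and "anticyclotomic",
§4.1 (Heeg) (journal = arXiv v2 numbering; arXiv v1 Def. 3.5 / Prop. 3.6, pp. 9–12);
[Castella2018] Thm. 3.1 and proof (arXiv:1704.06608 p. 9), the normalisation; [KellerYin2024b]
Prop. 3.1.3 p. 14 (`χ_ε`), §3.4 p. 19 (`ℒ_ε`; preprint — name only); [TateNTB1979] (3.2.3)
(unramified twist of the local constant).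
-/

noncomputable section

open scoped Classical

open NumberField IsDedekindDomain Field Literature.NumberTheory.EllipticCurves.ModularForms
open Literature.NumberTheory.GaloisRepresentations

universe u

namespace Literature.NumberTheory.EllipticCurves

/-- **Castella–Hsieh 2018, Definition 3.7 + Proposition 3.8 on the branch of a quadratic character
of conductor `p𝒪_K` (existence of the `χ`-branch `ℒ_𝔭(f)(χ̂ ·)` of the BDP anticyclotomic `p`-adic
`L`-function with its interpolation property, at a GOOD prime `p` split in `K`)** — named fact,
weight 2, in the currency of `IsBranchBDPLFunction` (sibling of
`castellaHsieh2018_exists_isBDPLFunction`, which keeps the unramified characters; this one keeps the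
characters `χφ` of conductor `p`, multiplier `e_𝔭 = ε(½, ·_𝔭)^{−2}`). Hypotheses, as printed in
Castella–Hsieh §3.3/§4.1 and VERBATIM those of the sibling: `f` the newform of the elliptic curve
`W/ℚ` at level `N`, `p` an ODD prime with `p ∤ N`, `K` imaginary quadratic with `p = 𝔭𝔭̄` SPLIT,
(Heeg) for `N`, `𝔭` the prime above `p` singled out by the embedding datum `ι : ℚ̄_p ≃ ℂ`, `κ` THE
anticyclotomic `ℤ_p`-extension, `γ` a topological generator; and the BRANCH CHARACTER `χ`:
quadratic (`χ² = 1`), unramified at every finite `w ∤ p`, of conductor exponent exactly `1` at every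
prime above `p` — i.e. (module docstring) `χ = χ_ε ν`, the genus character of conductor `p` times a
quadratic class-group character, every one of which is anticyclotomic ("trivial on `𝔸^×`", §3.3) of
conductor `p𝒪_K`, so that Prop. 3.8 applies to all `χφ`, `φ` unramified of infinity type `(−n, n)`.
Conclusion: a branch constant `e ≠ 0` (MEANT `ε(½, χ_𝔭)^{−2}` up to the absorbed `φ`-independent
constants — a sign for quadratic `χ`; not asserted), CM periods `Ω_K ∈ ℂ^×`, `Ω_p ∈ R₀^×`
("`(Ω_K, Ω_p) ∈ ℂ^× × 𝒲^×`") and `L ∈ R₀⟦T⟧` with `IsBranchBDPLFunction ι 𝔭 κ γ f χ e Ω_K Ω_p L`.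
NO hypothesis on `ρ̄_{E,p}`, NO `p ≥ 5`. A CONSEQUENCE of the printed statement exactly as the
sibling is (Castella 2018 Thm. 3.1's normalisation = the construction of Def. 3.7 read through
`Tw_{ψ⁻¹}`, here followed by `Tw_χ̂` and `Γ̃ ↠ Γ`; periods and `e` quantified existentially).
PUBLISHED (Math. Ann. 370 (2018)).
[cite: CastellaHsieh2018, Def. 3.7 and Prop. 3.8 with the §3.3 multiplier e_𝔭 for p ∣ c (journal = arXiv v2 numbering; = arXiv v1 Def. 3.5 / Prop. 3.6 and display before Prop. 3.4, pp. 10–11), §3.3 "anticyclotomic" (v1 p. 9), §4.1 (Heeg) (v1 p. 12)]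
[cite: Castella2018, Thm. 3.1 and proof (arXiv:1704.06608 p. 9), the normalisation `IsBDPLFunction`]
[cite: KellerYin2024b, §3.4 (arXiv:2410.23241 p. 19), the name `ℒ_ε := ℒ_p(f̃)(χ_ε)` only (preprint)] -/
def castellaHsieh2018_exists_isBranchBDPLFunction : Prop :=
  ∀ {p : ℕ} [Fact p.Prime] (ι : PadicAlgCl p ≃+* ℂ) (W : WeierstrassCurve ℚ) [W.IsElliptic]
    (K : Type) [Field K] [NumberField K] (𝔭 : HeightOneSpectrum (𝓞 K)) (κ : ZpExtension K p)
    (γ : absoluteGaloisGroup K) {N : ℕ} [NeZero N] {f : CuspForm (CongruenceSubgroup.Gamma0 N) 2}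
    (_ : IsNewformOf W f) (χ : HeckeCharacter K),
    p ≠ 2 → ¬ p ∣ N →
    IsImaginaryQuadratic K → ((Ideal.span {(p : ℤ)}).primesOver (𝓞 K)).ncard = 2 →
    ((p : ℕ) : 𝓞 K) ∈ 𝔭.asIdeal →
    (∀ (w : InfinitePlace K) (k : 𝓞 K),
      k ∈ 𝔭.asIdeal ↔ ‖ι.symm (w.embedding (k : K))‖ < 1) →
    SatisfiesHeegnerHypothesis N K →
    κ.IsAnticyclotomic → κ.IsTopGenerator γ →
    χ ^ 2 = 1 →
    (∀ w : HeightOneSpectrum (𝓞 K), ((p : ℕ) : 𝓞 K) ∉ w.asIdeal → χ.IsUnramifiedAt w) →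
    (∀ 𝔮 : HeightOneSpectrum (𝓞 K), ((p : ℕ) : 𝓞 K) ∈ 𝔮.asIdeal → χ.HasConductorExponentAt 𝔮 1) →
    ∃ (e : ℂ) (ΩK : ℂ) (Ωp : (unrIntegers p)ˣ) (L : UnrSeries p),
      e ≠ 0 ∧ ΩK ≠ 0 ∧ IsBranchBDPLFunction ι 𝔭 κ γ f χ e ΩK ((Ωp : unrIntegers p) : ℂ_[p]) L

end Literature.NumberTheory.EllipticCurves

end
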